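import Literature.NumberTheory.Automorphic.MokWeakBaseChange
import Literature.NumberTheory.Automorphic.AsaiSignContinuation
import HarnessLib

/-!
# Mok's standard base-change descent, corrected: the Asai hypothesis for the *continued* partial
# `L`-function, and the equivalence with the raw-product rendering under holomorphy on `Re s > 1`

Topic `NumberTheory/Automorphic`; namespace `Literature.NumberTheory.Automorphic`. Companion of
`MokWeakBaseChange` (the named fact `Mok2014_standardBaseChange_descent`) and of
`AsaiSignContinuation` (the corrected, continuation form of Mok's Asai-pole dichotomy). This file
declares theorems only (provefact unit 2026-08-16, verdict `misstated`; a proving seat may not mint a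
named fact, D-0026).

## The discrepancy

`Mok2014_standardBaseChange_descent` renders the "if" direction of Mok, Remark 2.5.5 (arXiv p. 21:
"given a unitary cuspidal automorphic representation `Π` of `GL_N(𝔸_E)` that is conjugate self-dual,
we have `Π` arises as "standard base change" from `U_{E/F}(N)` if and only if `L(s, Π, As^{(-1)^{N-1}})`
has a pole at `s = 1`"; from Thm. 2.4.2, p. 13, and Thm. 2.5.4 (a), p. 20) with the HYPOTHESIS
`HasAsaiSign Π c 1 = HasAsaiPole Π c (-1)^{N-1}`: for every Asai datum `(S, A)` of `Π` the **raw**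
partial Euler product `partialAsaiL S c A (-1)^{N-1}` — an unconditional `tprod` with the junk value
`1` wherever it is not multipliable — satisfies `(s - 1) L^S(s) → r ≠ 0` as `s → 1` on `{1 < Re s}`.
The printed hypothesis concerns Mok's `L(s, Π, As^±)`, the Langlands–Shahidi Asai `L`-functions
(local factors "studied in Goldberg [G], which are special cases of the `L`-functions studied by
Shahidi [S]", p. 20), i.e. the **meromorphic continuation** of an Euler product absolutely convergent
only "in some right half-plane `Re(s) > C`" (Grbac–Shahidi 2015, §2.A; Flicker 1988, Theorem
p. 297). For `N ≥ 3` neither implication between "raw pole at `1⁺`" and "pole of the continuation at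
`1`" is in print: either one amounts to comparing the raw product with its continuation on
`1 < Re s ≤ C`, i.e. to the convergence (at least the holomorphy) of the raw partial Asai product
there, which is exactly the unpublished ingredient isolated by the verdict on
`Mok2014_partialAsaiL_pole_dichotomy` (deprecation note in `AsaiSign.lean`; module docstring of
`AsaiSignContinuation.lean`: Jacquet–Shalika's bounds over `E` give `Re s > 3/2` only; `Re s > 1`
would follow from the Ramanujan conjecture for `Π` or from the automorphy of the Asai transfer,
known for `N ≤ 2`). Consequently the rendering is **incomparable** with the printed theorem: given a
raw pole at `As^{(-1)^{N-1}}`, Mok's theorems (Thm. 2.4.2: `Π` is a `ξ_{χ_κ}`-weak base change for a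
unique sign `κ`; §2.5: exactly one of the continued `L(s, Π, As^±)` has a pole at `1`) do not exclude
`κ(Π) = -1` with a raw `As^{(-1)^{N-1}}`-product misbehaving on `1 < Re s ≤ C`, so the fact cannot
be derived from [Mok2014] (nor from the automorphic descent of Ginzburg–Rallis–Soudry, whose
hypothesis is likewise a pole of the continued Asai `L`-function); and it is not weaker than print
either. Its docstring's justification ("the tree's `HasAsaiSign` is its partial (Satake) form, which
differs by finitely many local factors holomorphic and non-zero at `s = 1` … so the hypothesis used
here implies the printed one") addresses partial-versus-complete, not raw-versus-continued. (The underlying theorem is in any case far beyond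
an inline proof: Thm. 2.4.2 is Mok's "seed theorem", "proved by induction and comparison of trace
formulas … the complete proof will only be achieved at the end of section nine", p. 13.)

## What is vendored here

* The **corrected statement** — the right-hand side `D'` of
  `Mok2014_standardBaseChange_descent_iff_continuation` below (not declared as a `def` here,
  D-0026): same setting, objects and conclusion as `Mok2014_standardBaseChange_descent`, with the
  hypothesis in continuation form, verbatim the `As^{(-1)^{N-1}}`-clause (ii) of the corrected
  dichotomy (hypothesis `h` of `Mok2014_partialAsaiL_pole_dichotomy_of_continuation`): for every Asai
  datum `(S, A)` of `Π` there is `σ₀ ≥ 1` such that the partial `As^{(-1)^{N-1}}` Euler product is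
  multipliable on `Re s > σ₀` and `(s - 1) L^S(s, Π, As^{(-1)^{N-1}})` extends from `Re s > σ₀` to a
  function `G` holomorphic on `{1/2 < Re s}` with `G(1) ≠ 0` — the continued partial Asai
  `L`-function has a (simple) pole at `s = 1`. *Why this hypothesis implies the printed one* (so that
  `D'` is weaker than print): a pole at `s = 1` of the continued partial function
  `L^S = L / ∏_{v ∈ S or v ∣ ∞} L_v` is a pole of the complete `L(s, Π, As^{(-1)^{N-1}})`, the omitted
  local factors (reciprocals of polynomials in `q_v^{-s}`, Gamma factors) being nowhere zero; asking
  it for every Asai datum only strengthens the hypothesis; and by Mok's dichotomy a pole at `1` is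
  simple, so nothing is lost by rendering it as a simple pole. Sources: Mok, Thm. 2.4.2 (p. 13), §2.5
  before Thm. 2.5.4 and Thm. 2.5.4 (a) (p. 20), Remark 2.5.5 (p. 21); the analytic frame is
  Grbac–Shahidi 2015, §2.A and Thm. 4.3 (2). In print all of this is conditional on the
  stabilisation of the twisted trace formula (Mok p. 22; since established by Mœglin–Waldspurger).
* `Mok2014_standardBaseChange_descent_iff_continuation` — **proved**: GIVEN the corrected dichotomy
  (hypothesis `hdich`, verbatim the `h` of `Mok2014_partialAsaiL_pole_dichotomy_of_continuation`) and
  the holomorphy of the raw partial Asai Euler products on the open half-plane `{1 < Re s}`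
  (hypothesis `hhol`, verbatim the one of that theorem — the unpublished ingredient), the mis-stated
  rendering `Mok2014_standardBaseChange_descent` and the corrected statement `D'` are equivalent.
  (`→` uses `hhol` only: a continued simple pole is a raw pole once the raw product is holomorphic
  on `{1 < Re s}`, by the identity theorem, `tendsto_nhdsWithin_one_lt_re_of_continuation`.
  `←` uses both: a raw pole at `As^{(-1)^{N-1}}` forces the sign `η(Π)` of the dichotomy to be
  `(-1)^{N-1}` — otherwise the holomorphic continuation `H` of `L^S(s, Π, As^{(-1)^{N-1}})` would give
  `(s - 1) L^S(s) → 0`, `not_tendsto_of_tendsto_sub_one_mul` — whence the continued pole.) This pins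
  down exactly what separates the mis-stated rendering from print.
* The two POINTWISE bridges behind it, for one representation datum `π` and one sign (proved,
  folklore complex analysis on top of `AsaiSignContinuation`):
  `AutomorphicRepData.hasAsaiPole_of_continuation` (continued simple pole for every Asai datum + raw
  products holomorphic on `{1 < Re s}` ⇒ the raw-limit `HasAsaiPole`) and
  `AutomorphicRepData.HasAsaiPole.false_of_holomorphic_continuation` (a raw pole at `η` is
  incompatible with a holomorphic continuation of `L^S(s, Π, As^η)` to `{1/2 < Re s}`, raw product
  holomorphic on `{1 < Re s}`). For a single `Π` whose raw partial Asai products are known to converge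
  locally uniformly on `{1 < Re s}` (e.g. `Π_w` tempered at almost all `w`) these convert between the
  two currencies without any global hypothesis.

* **The tempered case, unconditionally** (appended 2026-08-16, theorems only): if the Satake
  parameters recorded by the Satake family have norm `≤ 1` above the complement of `S` (the
  Ramanujan bound — e.g. `Π` regular algebraic conjugate self-dual cuspidal, tempered at all finite
  places), the raw partial Asai Euler product is holomorphic and non-zero on `{1 < Re s}`
  (`differentiableOn_partialAsaiL_of_norm_le_one`: each unramified Asai factor is a product of at
  most `N + C(N,2) + N²` factors `1 - z q_v^{-ks}`, `‖z‖ ≤ 1`, `k ∈ {1, 2}`,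
  `norm_eval_asaiLocalPolynomial_sub_one_le`; Weierstrass `M`-test on every half-plane
  `Re s > σ₁ > 1` against `∑_v q_v^{-σ₁} < ∞`, `differentiableOn_partialAsaiL_of_norm_sub_one_le` —
  the Asai twin of `differentiableOn_partialStandardL_of_norm_sub_one_le`). Hence for such `Π` the
  hypothesis `hhol` disappears: `AutomorphicRepData.hasAsaiPole_of_continuation_of_norm_le_one`,
  `AutomorphicRepData.HasAsaiPole.false_of_holomorphic_continuation_of_norm_le_one`, and the
  route-usable form of the vendored fact with the PRINTED hypothesis,
  `Mok2014_standardBaseChange_descent.exists_isWeakBaseChange_of_continuation` (given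
  `Mok2014_standardBaseChange_descent`, a tempered conjugate self-dual cuspidal `Π` whose continued
  partial `As^{(-1)^{N-1}}` `L`-functions have a simple pole at `1` is a weak base change from
  `U_{E/F}(N)`).

Nothing of `MokWeakBaseChange` is touched here; deprecating `Mok2014_standardBaseChange_descent` and
vendoring `D'` as a named fact are left to the verdict clean-up / a cite item, as was done for
`Mok2014_partialAsaiL_pole_dichotomy`.

## References

* C. P. Mok, *Endoscopic classification of representations of quasi-split unitary groups*,
  Mem. Amer. Math. Soc. 235 (2015), no. 1108 (arXiv:1206.0882): Thm. 2.4.2 (p. 13), §2.5 and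
  Thm. 2.5.4 (a) (p. 20), Remark 2.5.5 (p. 21), p. 22 (conditionality). [Mok2014]
* N. Grbac, F. Shahidi, *Endoscopic transfer for unitary groups and holomorphy of Asai
  `L`-functions*, Pacific J. Math. 276 (2015), 185–211: §2.A, Thm. 4.3 (2). [GrbacShahidi2015]
* Y. Z. Flicker, *Twisted tensors and Euler products*, Bull. Soc. Math. France 116 (1988),
  295–313: Theorem p. 297. [Flicker1988]
* D. Ginzburg, S. Rallis, D. Soudry, *The descent map from automorphic representations of `GL(n)`
  to classical groups*, World Scientific (2011). [GinzburgRallisSoudry2011]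
-/

noncomputable section

open scoped Topology Classical
open NumberField IsDedekindDomain Filter

namespace Literature.NumberTheory.Automorphic

/-! ### Pointwise bridges between the raw-limit and the continuation currency of an Asai pole -/

section Bridges

variable {F E : Type} [Field F] [NumberField F] [Field E] [NumberField E] [Algebra F E]
  {N : ℕ} {hcpt : isCompact_glFiniteIntegralLevel N E}
  {π : AutomorphicRepData (AutomorphyDatum.gl N E hcpt)} {c : E ≃ₐ[F] E} {η : ℤˣ}

/-- **From a continued simple pole to the raw-limit pole.** If for every Asai datum `(S, A)` of `π`
the raw partial Asai Euler product `L^S(s, Π, As^η)` is holomorphic on `{1 < Re s}` and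
`(s - 1) L^S(s, Π, As^η)` agrees on some right half-plane `Re s > σ₀` (`σ₀ ≥ 1`) with a function `G`
holomorphic on `{1/2 < Re s}`, `G(1) ≠ 0`, then `π.HasAsaiPole c η` (the raw-limit currency of
`AsaiSign`): on `{1 < Re s}` the raw product coincides with its continuation (identity theorem,
`tendsto_nhdsWithin_one_lt_re_of_continuation`), so `(s - 1) L^S(s) → G(1) ≠ 0`. [folklore] -/
theorem AutomorphicRepData.hasAsaiPole_of_continuation
    (hhol : ∀ ⦃S : Set (HeightOneSpectrum (𝓞 F))⦄ ⦃A : SatakeFamily E⦄, π.IsAsaiDatum c S A →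
      DifferentiableOn ℂ (partialAsaiL S c A η) {s : ℂ | 1 < s.re})
    (hcont : ∀ ⦃S : Set (HeightOneSpectrum (𝓞 F))⦄ ⦃A : SatakeFamily E⦄, π.IsAsaiDatum c S A →
      ∃ σ₀ : ℝ, 1 ≤ σ₀ ∧ ∃ G : ℂ → ℂ, DifferentiableOn ℂ G {s : ℂ | 1 / 2 < s.re} ∧
        (∀ s : ℂ, σ₀ < s.re → G s = (s - 1) * partialAsaiL S c A η s) ∧ G 1 ≠ 0) :
    π.HasAsaiPole c η := by
  intro S A hSA
  obtain ⟨σ₀, hσ₀, G, hG, hGL, hG1⟩ := hcont hSA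
  refine ⟨G 1, hG1, ?_⟩
  have hf : DifferentiableOn ℂ (fun s => (s - 1) * partialAsaiL S c A η s) {s : ℂ | 1 < s.re} :=
    (differentiableOn_id.sub_const 1).mul (hhol hSA)
  exact tendsto_nhdsWithin_one_lt_re_of_continuation hσ₀ hG hf hGL

/-- **A raw pole excludes a holomorphic continuation.** If `π.HasAsaiPole c η` (raw-limit pole:
`(s - 1) L^S(s, Π, As^η) → r ≠ 0` as `s → 1⁺`), the raw product `L^S(s, Π, As^η)` of an Asai datum
`(S, A)` is holomorphic on `{1 < Re s}`, and a function `H` holomorphic on `{1/2 < Re s}` agrees with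
it on a right half-plane `Re s > σ₀` (`σ₀ ≥ 1`), contradiction: `L^S(s) → H(1)` along `s → 1⁺`
(identity theorem), hence `(s - 1) L^S(s) → 0` (`not_tendsto_of_tendsto_sub_one_mul`). [folklore] -/
theorem AutomorphicRepData.HasAsaiPole.false_of_holomorphic_continuation (hpole : π.HasAsaiPole c η)
    {S : Set (HeightOneSpectrum (𝓞 F))} {A : SatakeFamily E} (hSA : π.IsAsaiDatum c S A)
    (hhol : DifferentiableOn ℂ (partialAsaiL S c A η) {s : ℂ | 1 < s.re})
    {σ₀ : ℝ} (hσ₀ : 1 ≤ σ₀) {H : ℂ → ℂ} (hH : DifferentiableOn ℂ H {s : ℂ | 1 / 2 < s.re})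
    (hHL : ∀ s : ℂ, σ₀ < s.re → H s = partialAsaiL S c A η s) : False := by
  obtain ⟨r, hr, hrt⟩ := hpole hSA
  have ht : Tendsto (partialAsaiL S c A η) (𝓝[{s : ℂ | 1 < s.re}] 1) (𝓝 (H 1)) :=
    tendsto_nhdsWithin_one_lt_re_of_continuation hσ₀ hH hhol hHL
  exact not_tendsto_of_tendsto_sub_one_mul hr hrt (H 1) ht

end Bridges

/-! ### The mis-stated rendering versus the corrected statement -/

/-- **Mok's standard base-change descent: the raw-product rendering versus the corrected
(continuation) statement.**

*The right-hand side `D'` — the corrected statement.* Printed: Mok, Remark 2.5.5 (arXiv p. 21):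
"given a unitary cuspidal automorphic representation `Π` of `GL_N(𝔸_E)` that is conjugate self-dual,
we have `Π` arises as "standard base change" from `U_{E/F}(N)` if and only if
`L(s, Π, As^{(-1)^{N-1}})` has a pole at `s = 1`"; Thm. 2.4.2 (p. 13): "there exists a unique (up to
equivalence) twisted endoscopic data `(G, ξ_{χ_κ}) ∈ Ẽ_ell(N)`, such that `c(φ^N) = ξ_{χ_κ}(c(π))` for
some representation `π` in the discrete automorphic spectrum of `G(𝔸_F)` … of the form
`(U_{E/F}(N), ξ_{χ_κ})` for a unique `κ ∈ {±1}`"; Thm. 2.5.4 (a) (p. 20): "the Asai `L`-function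
`L(s, φ^N, As^η)` has a pole at `s = 1`, where `η = (-1)^{N-1} · κ`", these `L(s, φ^N, As^±)` being
the Langlands–Shahidi Asai `L`-functions (meromorphic continuations of a product absolutely
convergent for `Re(s) > C`, Grbac–Shahidi 2015, §2.A). Rendering of `D'`: for `E/F` quadratic with
non-trivial automorphism `c`, `N ≥ 1`, every cuspidal automorphic representation datum `Π` of
`GL_N(𝔸_E)` which is conjugate self-dual a.e. (`IsConjSelfDualAE`) and whose partial Asai
`L`-function of sign `(-1)^{N-1}` has, for every Asai datum `(S, A)`, a CONTINUED simple pole at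
`s = 1` — some `σ₀ ≥ 1` with the partial `As^{(-1)^{N-1}}` Euler product multipliable on `Re s > σ₀`
and a function `G` holomorphic on `{1/2 < Re s}` with `G(s) = (s - 1) L^S(s, Π, As^{(-1)^{N-1}})`
for `Re s > σ₀` and `G(1) ≠ 0` (verbatim clause (ii) of the corrected dichotomy, the hypothesis `h`
of `Mok2014_partialAsaiL_pole_dichotomy_of_continuation`) — is a weak base change
(`UnitaryGroup.IsWeakBaseChange`, standard `ξ_1`) of some automorphic representation datum `π` of
`U_{E/F}(N)(𝔸_F)` (printed: of some `π` in the discrete spectrum; weaker).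

*The left-hand side* is the mis-stated rendering `Mok2014_standardBaseChange_descent`, whose
hypothesis `HasAsaiSign Π c 1` is the RAW-product pole `(s - 1) · partialAsaiL S c A (-1)^{N-1} s → r ≠ 0`
(`s → 1`, `Re s > 1`) for every Asai datum — a condition whose relation to the printed one is not
in the literature for `N ≥ 3` (module docstring).

*The theorem.* Given the corrected dichotomy `hdich` (verbatim the hypothesis `h` of
`Mok2014_partialAsaiL_pole_dichotomy_of_continuation`: Mok §2.5 and Thm. 2.5.4 (a); Grbac–Shahidi
2015, Thm. 4.3 (2)) and the holomorphy `hhol` of the raw partial Asai Euler products on `{1 < Re s}`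
(not in print for `N ≥ 3`; a consequence of locally uniform convergence there, e.g. under the
Ramanujan conjecture for `Π`), the two renderings are equivalent: `→` by the identity theorem on
`{1 < Re s}` (`tendsto_nhdsWithin_one_lt_re_of_continuation`; uses `hhol` only), `←` because a raw
pole at `As^{(-1)^{N-1}}` excludes, through the holomorphic continuation `H` of the other function,
the sign `-(-1)^{N-1}` in the dichotomy (`not_tendsto_of_tendsto_sub_one_mul`).
[cite: Mok2014, Thm. 2.4.2 (arXiv p. 13), Thm. 2.5.4 (a) and Remark 2.5.5 (arXiv pp. 20–21)]
[cite: GrbacShahidi2015, §2.A and Thm. 4.3 (2)] -/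
theorem Mok2014_standardBaseChange_descent_iff_continuation
    (hdich : ∀ (F E : Type) [Field F] [NumberField F] [Field E] [NumberField E] [Algebra F E]
        (c : E ≃ₐ[F] E), Module.finrank F E = 2 → c ≠ 1 →
        ∀ (N : ℕ) (hcpt : isCompact_glFiniteIntegralLevel N E)
          (π : CuspidalAutomorphicRepData N E hcpt), 0 < N → π.1.IsConjSelfDualAE c →
          ∃ η : ℤˣ, ∀ (S : Set (HeightOneSpectrum (𝓞 F))) (A : SatakeFamily E),
            π.1.IsAsaiDatum c S A →
              ∃ σ₀ : ℝ, 1 ≤ σ₀ ∧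
                (∀ (θ : ℤˣ) (s : ℂ), σ₀ < s.re →
                  Multipliable fun v : {v : HeightOneSpectrum (𝓞 F) // v ∉ S} =>
                    ((asaiLocalPolynomial c A θ (placeAbove E v.1)).eval
                      ((v.1.residueCard : ℂ) ^ (-s)))⁻¹) ∧
                (∃ G : ℂ → ℂ, DifferentiableOn ℂ G {s : ℂ | 1 / 2 < s.re} ∧
                  (∀ s : ℂ, σ₀ < s.re → G s = (s - 1) * partialAsaiL S c A η s) ∧ G 1 ≠ 0) ∧
                (∃ H : ℂ → ℂ, DifferentiableOn ℂ H {s : ℂ | 1 / 2 < s.re} ∧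
                  (∀ s : ℂ, σ₀ < s.re → H s = partialAsaiL S c A (-η) s) ∧ H 1 ≠ 0))
    (hhol : ∀ (F E : Type) [Field F] [NumberField F] [Field E] [NumberField E] [Algebra F E]
      (c : E ≃ₐ[F] E), Module.finrank F E = 2 → c ≠ 1 →
      ∀ (N : ℕ) (hcpt : isCompact_glFiniteIntegralLevel N E)
        (π : CuspidalAutomorphicRepData N E hcpt), 0 < N → π.1.IsConjSelfDualAE c →
        ∀ (S : Set (HeightOneSpectrum (𝓞 F))) (A : SatakeFamily E) (θ : ℤˣ),
          π.1.IsAsaiDatum c S A → DifferentiableOn ℂ (partialAsaiL S c A θ) {s : ℂ | 1 < s.re}) :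
    Mok2014_standardBaseChange_descent ↔
      ∀ (F E : Type) [Field F] [NumberField F] [Field E] [NumberField E] [Algebra F E]
        (c : E ≃ₐ[F] E), Module.finrank F E = 2 → c ≠ 1 →
        ∀ (N : ℕ) (hcpt : isCompact_glFiniteIntegralLevel N E)
          (P : CuspidalAutomorphicRepData N E hcpt), 0 < N → P.1.IsConjSelfDualAE c →
          (∀ (S : Set (HeightOneSpectrum (𝓞 F))) (A : SatakeFamily E), P.1.IsAsaiDatum c S A →
              ∃ σ₀ : ℝ, 1 ≤ σ₀ ∧
                (∀ s : ℂ, σ₀ < s.re →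
                  Multipliable fun v : {v : HeightOneSpectrum (𝓞 F) // v ∉ S} =>
                    ((asaiLocalPolynomial c A ((-1) ^ (N + 1)) (placeAbove E v.1)).eval
                      ((v.1.residueCard : ℂ) ^ (-s)))⁻¹) ∧
                ∃ G : ℂ → ℂ, DifferentiableOn ℂ G {s : ℂ | 1 / 2 < s.re} ∧
                  (∀ s : ℂ, σ₀ < s.re →
                    G s = (s - 1) * partialAsaiL S c A ((-1) ^ (N + 1)) s) ∧ G 1 ≠ 0) →
          ∃ π : UnitaryGroupAutomorphicRep F E c N hcpt,
            UnitaryGroup.IsWeakBaseChange F E c N hcpt P.1 π := by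
  constructor
  · -- `→`: a continued simple pole is a raw pole once the raw product is holomorphic on `{1 < Re s}`
    intro hD F E _ _ _ _ _ c h2 hc N hcpt P hN hcsd hcont
    refine hD F E c h2 hc N hcpt P hN hcsd ?_
    rw [AutomorphicRepData.hasAsaiSign_iff, mul_one]
    exact AutomorphicRepData.hasAsaiPole_of_continuation
      (fun S A hSA => hhol F E c h2 hc N hcpt P hN hcsd S A _ hSA)
      fun S A hSA => by
        obtain ⟨σ₀, hσ₀, -, hG⟩ := hcont S A hSA
        exact ⟨σ₀, hσ₀, hG⟩
  · -- `←`: a raw pole at `As^{(-1)^{N-1}}` forces the sign of the dichotomy, whence the continued pole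
    intro h F E _ _ _ _ _ c h2 hc N hcpt P hN hcsd hsign
    refine h F E c h2 hc N hcpt P hN hcsd fun S A hSA => ?_
    obtain ⟨η, hη⟩ := hdich F E c h2 hc N hcpt P hN hcsd
    obtain ⟨σ₀, hσ₀, hmult, ⟨G, hG, hGL, hG1⟩, ⟨H, hH, hHL, -⟩⟩ := hη S A hSA
    -- the raw pole at `(-1)^{N-1}` given by the hypothesis of the mis-stated rendering
    have hpole : P.1.HasAsaiPole c ((-1) ^ (N + 1)) := by
      simpa only [AutomorphicRepData.hasAsaiSign_iff, mul_one] using hsign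
    -- the sign `(-1)^{N-1}`, as an opaque unit `θ`
    set θ : ℤˣ := (-1) ^ (N + 1) with hθ
    clear_value θ
    by_cases hηθ : η = θ
    · subst hηθ
      exact ⟨σ₀, hσ₀, fun s hs => hmult _ s hs, G, hG, hGL, hG1⟩
    · have hneg : -η = θ := by rw [Int.units_ne_iff_eq_neg.mp hηθ, neg_neg]
      exact (hpole.false_of_holomorphic_continuation hSA
        (hhol F E c h2 hc N hcpt P hN hcsd S A θ hSA) hσ₀ hH
        (fun s hs => by rw [hHL s hs, hneg])).elim

/-! ### Satake parameters of norm at most one: the raw partial Asai product is holomorphic on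
`{1 < Re s}` (the ingredient `hhol`, discharged for tempered data) -/

section TemperedLocal

open Polynomial

/-- If every factor `f` of a finite product satisfies `‖f - 1‖ ≤ δ ≤ 1`, then
`‖∏ f - 1‖ ≤ (2 ^ K - 1) δ`, `K` the number of factors. [folklore] -/
theorem norm_multiset_prod_sub_one_le {δ : ℝ} (hδ₀ : 0 ≤ δ) (hδ₁ : δ ≤ 1) (M : Multiset ℂ)
    (h : ∀ f ∈ M, ‖f - 1‖ ≤ δ) : ‖M.prod - 1‖ ≤ (2 ^ Multiset.card M - 1) * δ := by
  induction M using Multiset.induction_on with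
  | empty => simp
  | cons f M ih =>
    have hf : ‖f - 1‖ ≤ δ := h f (Multiset.mem_cons_self f M)
    have hM : ‖M.prod - 1‖ ≤ (2 ^ Multiset.card M - 1) * δ :=
      ih fun g hg => h g (Multiset.mem_cons_of_mem hg)
    have h2 : (1 : ℝ) ≤ 2 ^ Multiset.card M := one_le_pow₀ (by norm_num)
    have hP : ‖M.prod‖ ≤ 2 ^ Multiset.card M := by
      have h1 : ‖M.prod‖ ≤ ‖M.prod - 1‖ + 1 := by
        calc ‖M.prod‖ = ‖(M.prod - 1) + 1‖ := by rw [sub_add_cancel]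
          _ ≤ ‖M.prod - 1‖ + ‖(1 : ℂ)‖ := norm_add_le _ _
          _ = ‖M.prod - 1‖ + 1 := by rw [norm_one]
      have h3 : (2 ^ Multiset.card M - 1) * δ ≤ (2 ^ Multiset.card M - 1) * 1 :=
        mul_le_mul_of_nonneg_left hδ₁ (by linarith)
      linarith
    rw [Multiset.prod_cons, Multiset.card_cons, pow_succ]
    calc ‖f * M.prod - 1‖ = ‖(f - 1) * M.prod + (M.prod - 1)‖ := by ring_nf
      _ ≤ ‖(f - 1) * M.prod‖ + ‖M.prod - 1‖ := norm_add_le _ _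
      _ = ‖f - 1‖ * ‖M.prod‖ + ‖M.prod - 1‖ := by rw [norm_mul]
      _ ≤ δ * 2 ^ Multiset.card M + (2 ^ Multiset.card M - 1) * δ := by
          gcongr
      _ = (2 ^ Multiset.card M * 2 - 1) * δ := by ring

/-- If every factor `f` of a finite product satisfies `‖f - 1‖ < 1`, the product is non-zero.
[folklore] -/
theorem multiset_prod_ne_zero_of_norm_sub_one_lt_one (M : Multiset ℂ)
    (h : ∀ f ∈ M, ‖f - 1‖ < 1) : M.prod ≠ 0 := by
  refine Multiset.prod_ne_zero fun h0 => ?_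
  have := h 0 h0
  rw [zero_sub, norm_neg, norm_one] at this
  exact lt_irrefl _ this

/-- The sign `η = ±1` has norm one in `ℂ`. [folklore] -/
private theorem norm_intCast_units (η : ℤˣ) : ‖(((η : ℤ) : ℂ))‖ = 1 := by
  rcases Int.units_eq_one_or η with rfl | rfl <;> simp

variable {F E : Type} [Field F] [Field E] [Algebra F E]

/-- **The unramified Asai factor is a product of factors `1 - z x^k` with `‖z‖ ≤ 1`, `k ∈ {1, 2}`,
when the Satake parameters have norm at most one.** For `‖x‖ ≤ 1` and Satake parameters of norm
`≤ 1` at `w` and `c • w`, `(asaiLocalPolynomial c A η w)(x)` is a product of at most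
`card (A w) + C(card (A w), 2) + card (A w) · card (A (c • w))` complex numbers `f` with
`‖f - 1‖ ≤ ‖x‖` (inert: `f = 1 - η a x` or `1 - a b x²`; split: `f = 1 - a b x`). [folklore] -/
theorem exists_eval_asaiLocalPolynomial_eq_multiset_prod (c : E ≃ₐ[F] E) (A : SatakeFamily E)
    (η : ℤˣ) (w : HeightOneSpectrum (𝓞 E)) {x : ℂ} (hx : ‖x‖ ≤ 1)
    (hw : ∀ a ∈ A w, ‖a‖ ≤ 1) (hcw : ∀ a ∈ A (c • w), ‖a‖ ≤ 1) :
    ∃ M : Multiset ℂ, (asaiLocalPolynomial c A η w).eval x = M.prod ∧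
      Multiset.card M ≤ Multiset.card (A w) + (Multiset.card (A w)).choose 2 +
        Multiset.card (A w) * Multiset.card (A (c • w)) ∧
      ∀ f ∈ M, ‖f - 1‖ ≤ ‖x‖ := by
  by_cases hfix : c • w = w
  · -- inert: `∏_a (1 - η a x) · ∏_{a,b} (1 - a b x²)`
    refine ⟨(A w).map (fun a => 1 - ((η : ℤ) : ℂ) * a * x) +
      ((A w).powersetCard 2).map (fun p => 1 - p.prod * x ^ 2), ?_, ?_, ?_⟩
    · rw [asaiLocalPolynomial_of_smul_eq A η hfix, asaiInertPolynomial, eval_mul,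
        eval_multiset_prod, eval_multiset_prod, Multiset.prod_add, Multiset.map_map,
        Multiset.map_map]
      congr 1
      · refine congrArg _ (Multiset.map_congr rfl fun a _ => ?_)
        simp
      · refine congrArg _ (Multiset.map_congr rfl fun p _ => ?_)
        simp
    · rw [Multiset.card_add, Multiset.card_map, Multiset.card_map, Multiset.card_powersetCard]
      exact Nat.le_add_right _ _
    · intro f hf
      rw [Multiset.mem_add] at hf
      rcases hf with hf | hf
      · obtain ⟨a, ha, rfl⟩ := Multiset.mem_map.mp hf
        rw [sub_sub_cancel_left, norm_neg, norm_mul, norm_mul, norm_intCast_units, one_mul]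
        calc ‖a‖ * ‖x‖ ≤ 1 * ‖x‖ := by gcongr; exact hw a ha
          _ = ‖x‖ := one_mul _
      · obtain ⟨p, hp, rfl⟩ := Multiset.mem_map.mp hf
        obtain ⟨hple, hpcard⟩ := Multiset.mem_powersetCard.mp hp
        obtain ⟨a, b, rfl⟩ := Multiset.card_eq_two.mp hpcard
        have ha : ‖a‖ ≤ 1 := hw a (Multiset.mem_of_le hple (by simp))
        have hb : ‖b‖ ≤ 1 := hw b (Multiset.mem_of_le hple (by simp))
        rw [sub_sub_cancel_left, norm_neg, norm_mul, Multiset.insert_eq_cons, Multiset.prod_cons,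
          Multiset.prod_singleton, norm_mul, norm_pow]
        calc ‖a‖ * ‖b‖ * ‖x‖ ^ 2 ≤ 1 * 1 * ‖x‖ ^ 2 := by gcongr
          _ = ‖x‖ * ‖x‖ := by ring
          _ ≤ 1 * ‖x‖ := by gcongr
          _ = ‖x‖ := one_mul _
  · -- split: `∏_{a, b} (1 - a b x)`
    refine ⟨(satakeTensor (A w) (A (c • w))).map (fun z => 1 - z * x), ?_, ?_, ?_⟩
    · rw [asaiLocalPolynomial_of_smul_ne A η hfix, satakePairPolynomial_eq_eulerPolynomial,
        eval_eulerPolynomial]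
    · rw [Multiset.card_map, card_satakeTensor]
      exact Nat.le_add_left _ _
    · intro f hf
      obtain ⟨z, hz, rfl⟩ := Multiset.mem_map.mp hf
      obtain ⟨p, hp, rfl⟩ := Multiset.mem_map.mp hz
      obtain ⟨ha, hb⟩ := Multiset.mem_product.mp hp
      rw [sub_sub_cancel_left, norm_neg, norm_mul, norm_mul]
      calc ‖p.1‖ * ‖p.2‖ * ‖x‖ ≤ 1 * 1 * ‖x‖ := by gcongr; exacts [hw _ ha, hcw _ hb]
        _ = ‖x‖ := by ring

/-- **Estimate and non-vanishing of the unramified Asai factor for Satake parameters of norm at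
most one**: for `‖x‖ ≤ 1`, `‖(asaiLocalPolynomial c A η w)(x) - 1‖ ≤ (2 ^ K - 1) ‖x‖` with
`K = card (A w) + C(card (A w), 2) + card (A w) · card (A (c • w))`, and for `‖x‖ < 1` the factor
does not vanish. [folklore] -/
theorem norm_eval_asaiLocalPolynomial_sub_one_le (c : E ≃ₐ[F] E) (A : SatakeFamily E)
    (η : ℤˣ) (w : HeightOneSpectrum (𝓞 E)) {x : ℂ} (hx : ‖x‖ ≤ 1)
    (hw : ∀ a ∈ A w, ‖a‖ ≤ 1) (hcw : ∀ a ∈ A (c • w), ‖a‖ ≤ 1) :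
    ‖(asaiLocalPolynomial c A η w).eval x - 1‖ ≤
      (2 ^ (Multiset.card (A w) + (Multiset.card (A w)).choose 2 +
        Multiset.card (A w) * Multiset.card (A (c • w))) - 1) * ‖x‖ := by
  obtain ⟨M, hM, hcard, hf⟩ := exists_eval_asaiLocalPolynomial_eq_multiset_prod c A η w hx hw hcw
  rw [hM]
  refine (norm_multiset_prod_sub_one_le (norm_nonneg x) hx M hf).trans ?_
  have h2 : (2 : ℝ) ^ Multiset.card M ≤
      2 ^ (Multiset.card (A w) + (Multiset.card (A w)).choose 2 +
        Multiset.card (A w) * Multiset.card (A (c • w))) :=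
    pow_le_pow_right₀ (by norm_num) hcard
  exact mul_le_mul_of_nonneg_right (by linarith) (norm_nonneg x)

/-- **Non-vanishing of the unramified Asai factor** for Satake parameters of norm at most one and
`‖x‖ < 1`: every factor `f` of `exists_eval_asaiLocalPolynomial_eq_multiset_prod` has `‖f - 1‖ < 1`.
[folklore] -/
theorem eval_asaiLocalPolynomial_ne_zero (c : E ≃ₐ[F] E) (A : SatakeFamily E)
    (η : ℤˣ) (w : HeightOneSpectrum (𝓞 E)) {x : ℂ} (hx : ‖x‖ < 1)
    (hw : ∀ a ∈ A w, ‖a‖ ≤ 1) (hcw : ∀ a ∈ A (c • w), ‖a‖ ≤ 1) :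
    (asaiLocalPolynomial c A η w).eval x ≠ 0 := by
  obtain ⟨M, hM, -, hf⟩ := exists_eval_asaiLocalPolynomial_eq_multiset_prod c A η w hx.le hw hcw
  rw [hM]
  exact multiset_prod_ne_zero_of_norm_sub_one_lt_one M fun f hfM => (hf f hfM).trans_lt hx

end TemperedLocal

section TemperedGlobal

variable {F E : Type} [Field F] [NumberField F] [Field E] [NumberField E] [Algebra F E]

/-- Holomorphy on an open right half-plane from holomorphy on every strictly smaller one
(a `private` copy of the lemma of `GodementJacquetPartialL`, whose imports are not wanted here).
[folklore] -/
private theorem differentiableOn_halfPlane_of_forall_lt_aux {f : ℂ → ℂ} {σ₀ : ℝ}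
    (h : ∀ σ₁ : ℝ, σ₀ < σ₁ → DifferentiableOn ℂ f {s : ℂ | σ₁ < s.re}) :
    DifferentiableOn ℂ f {s : ℂ | σ₀ < s.re} := by
  intro s hs
  have hs' : σ₀ < s.re := hs
  have h₁ : σ₀ < (σ₀ + s.re) / 2 := by linarith
  have h₂ : (σ₀ + s.re) / 2 < s.re := by linarith
  exact ((h _ h₁).differentiableAt
    ((isOpen_lt continuous_const Complex.continuous_re).mem_nhds h₂)).differentiableWithinAt

omit [NumberField E] in
/-- **Weierstrass: holomorphy and non-vanishing of the raw partial Asai Euler product on a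
half-plane of normal convergence.** If on `re s > σ₀` the local Asai factors
`P_v(s) = (asaiLocalPolynomial c A η w_v)(q_v^{-s})`, `v ∉ S`, satisfy `‖P_v(s) - 1‖ ≤ u_v` with
`∑_v u_v < ∞` and do not vanish, then `L^S(s, A, As^η) = ∏'_{v ∉ S} P_v(s)⁻¹` (`partialAsaiL`) is
holomorphic and non-zero on `re s > σ₀` (the product `∏_v P_v(s)` converges locally uniformly, Mathlib
`Summable.hasProdLocallyUniformlyOn_one_add`; its value is holomorphic,
`TendstoLocallyUniformlyOn.differentiableOn`, and non-zero, `tprod_one_add_ne_zero_of_summable`; and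
`L^S` is its inverse). The Asai twin of `differentiableOn_partialStandardL_of_norm_sub_one_le`
(Jacquet–Shalika 1981, (5.1.4); Flicker 1988, Theorem p. 297: "absolutely convergent … in some
right half-plane"). [folklore] -/
theorem differentiableOn_partialAsaiL_of_norm_sub_one_le {S : Set (HeightOneSpectrum (𝓞 F))}
    {c : E ≃ₐ[F] E} {A : SatakeFamily E} {η : ℤˣ} {σ₀ : ℝ}
    {u : {v : HeightOneSpectrum (𝓞 F) // v ∉ S} → ℝ} (hu : Summable u)
    (hle : ∀ (v : {v : HeightOneSpectrum (𝓞 F) // v ∉ S}) (s : ℂ), σ₀ < s.re →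
      ‖(asaiLocalPolynomial c A η (placeAbove E v.1)).eval ((v.1.residueCard : ℂ) ^ (-s)) - 1‖ ≤
        u v)
    (hne : ∀ (v : {v : HeightOneSpectrum (𝓞 F) // v ∉ S}) (s : ℂ), σ₀ < s.re →
      (asaiLocalPolynomial c A η (placeAbove E v.1)).eval ((v.1.residueCard : ℂ) ^ (-s)) ≠ 0) :
    DifferentiableOn ℂ (partialAsaiL S c A η) {s : ℂ | σ₀ < s.re} ∧
      ∀ s : ℂ, σ₀ < s.re → partialAsaiL S c A η s ≠ 0 := by
  set U : Set ℂ := {s : ℂ | σ₀ < s.re} with hU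
  have hUo : IsOpen U := isOpen_lt continuous_const Complex.continuous_re
  -- the local factors as entire functions of `s`
  set e : {v : HeightOneSpectrum (𝓞 F) // v ∉ S} → ℂ → ℂ := fun v s =>
    (asaiLocalPolynomial c A η (placeAbove E v.1)).eval ((v.1.residueCard : ℂ) ^ (-s)) with he
  have hed : ∀ v, Differentiable ℂ (e v) := fun v =>
    (asaiLocalPolynomial c A η (placeAbove E v.1)).differentiable.comp
      (differentiable_id.neg.const_cpow
        (Or.inl (Nat.cast_ne_zero.mpr (zero_lt_one.trans v.1.one_lt_residueCard).ne')))
  -- normal convergence of `∏_v (1 + (e_v - 1))` on `U`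
  have hprod : HasProdLocallyUniformlyOn (fun v s => 1 + (e v s - 1))
      (fun s => ∏' v, (1 + (e v s - 1))) U :=
    hu.hasProdLocallyUniformlyOn_one_add hUo
      (Eventually.of_forall fun v s hs => hle v s hs)
      (fun v => ((hed v).sub_const 1).continuous.continuousOn)
  set L : ℂ → ℂ := fun s => ∏' v, (1 + (e v s - 1)) with hL
  -- `L` is holomorphic on `U`, as a locally uniform limit of finite products of entire functions
  have hLd : DifferentiableOn ℂ L U := by
    refine (hasProdLocallyUniformlyOn_iff_tendstoLocallyUniformlyOn.mp hprod).differentiableOn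
      (Eventually.of_forall fun s' => ?_) hUo
    exact (Differentiable.fun_finsetProd fun v _ =>
      ((hed v).sub_const 1).const_add 1).differentiableOn
  -- at each point of `U`: `L s ≠ 0` and `L^S(s) = (L s)⁻¹`
  have hpt : ∀ s ∈ U, L s ≠ 0 ∧ partialAsaiL S c A η s = (L s)⁻¹ := by
    intro s hs
    have hsum : Summable fun v => ‖e v s - 1‖ :=
      hu.of_nonneg_of_le (fun v => norm_nonneg _) (fun v => hle v s hs)
    have hL0 : L s ≠ 0 :=
      tprod_one_add_ne_zero_of_summable (fun v => by rw [add_sub_cancel]; exact hne v s hs) hsum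
    refine ⟨hL0, ?_⟩
    have hP : HasProd (fun v => 1 + (e v s - 1)) (L s) := hprod.hasProd hs
    have hP₁ : HasProd (fun v => e v s) (L s) := by simpa only [add_sub_cancel] using hP
    have hP₂ : HasProd (fun v => (e v s)⁻¹) (L s)⁻¹ := by
      unfold HasProd at hP₁ ⊢
      simpa only [Finset.prod_inv_distrib] using hP₁.inv₀ hL0
    exact hP₂.tprod_eq
  refine ⟨?_, fun s hs => ?_⟩
  · exact (hLd.inv fun s hs => (hpt s hs).1).congr fun s hs => (hpt s hs).2
  · rw [(hpt s hs).2]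
    exact inv_ne_zero (hpt s hs).1

/-- **Satake parameters of norm at most one: the raw partial Asai Euler product is holomorphic and
non-zero on `{1 < Re s}`.** If above every place `v ∉ S` the Satake family `A` consists of
multisets of cardinality `≤ N` all of whose elements have norm `≤ 1` — e.g. the Satake parameters of
a cuspidal `Π` of `GL_N(𝔸_E)` that is *tempered* at the places above the complement of `S`
(the Ramanujan conjecture for `Π`; known for regular algebraic conjugate self-dual cuspidal `Π`) —,
then `s ↦ L^S(s, A, As^η)` (`partialAsaiL S c A η`) is holomorphic and non-zero on `{1 < Re s}`:
with `x = q_v^{-s}`, `‖x‖ = q_v^{-Re s} ≤ q_v^{-σ₁}` on `Re s > σ₁ > 1`, each local factor is a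
product of at most `K = N + C(N, 2) + N²` factors `1 - z x^k` with `‖z‖ ≤ 1`
(`norm_eval_asaiLocalPolynomial_sub_one_le`), so `‖P_v(s) - 1‖ ≤ 2^K q_v^{-σ₁}`, summable over
`v` (`summable_residueCard_rpow_neg`), and Weierstrass applies on every such half-plane
(`differentiableOn_partialAsaiL_of_norm_sub_one_le`). This is exactly the holomorphy hypothesis
`hhol` of `Mok2014_partialAsaiL_pole_dichotomy_of_continuation` and of
`Mok2014_standardBaseChange_descent_iff_continuation`, discharged for tempered data. [folklore] -/
theorem differentiableOn_partialAsaiL_of_norm_le_one {S : Set (HeightOneSpectrum (𝓞 F))}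
    (c : E ≃ₐ[F] E) {A : SatakeFamily E} (η : ℤˣ) (N : ℕ)
    (hA : ∀ w : HeightOneSpectrum (𝓞 E), w.under (𝓞 F) ∉ S →
      Multiset.card (A w) ≤ N ∧ ∀ a ∈ A w, ‖a‖ ≤ 1) :
    DifferentiableOn ℂ (partialAsaiL S c A η) {s : ℂ | 1 < s.re} ∧
      ∀ s : ℂ, 1 < s.re → partialAsaiL S c A η s ≠ 0 := by
  -- the number of factors of a local Asai polynomial is at most `K`
  set K : ℕ := N + N.choose 2 + N * N with hK
  -- data above `v ∉ S`: the chosen place `w_v` and its conjugate lie over `v`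
  have hw : ∀ v : {v : HeightOneSpectrum (𝓞 F) // v ∉ S}, (placeAbove E v.1).under (𝓞 F) ∉ S :=
    fun v => by rw [placeAbove_under]; exact v.2
  have hcw : ∀ v : {v : HeightOneSpectrum (𝓞 F) // v ∉ S},
      (c • placeAbove E v.1).under (𝓞 F) ∉ S :=
    fun v => by rw [HeightOneSpectrum.under_smul, placeAbove_under]; exact v.2
  -- `‖q_v^{-s}‖ = q_v^{-re s}`
  have hx : ∀ (v : {v : HeightOneSpectrum (𝓞 F) // v ∉ S}) (s : ℂ),
      ‖(v.1.residueCard : ℂ) ^ (-s)‖ = (v.1.residueCard : ℝ) ^ (-s.re) := fun v s => by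
    rw [Complex.norm_natCast_cpow_of_pos (zero_lt_one.trans v.1.one_lt_residueCard), Complex.neg_re]
  -- the estimate on `re s > σ₁`, for any `σ₁ > 1`
  have key : ∀ σ₁ : ℝ, 1 < σ₁ →
      DifferentiableOn ℂ (partialAsaiL S c A η) {s : ℂ | σ₁ < s.re} ∧
        ∀ s : ℂ, σ₁ < s.re → partialAsaiL S c A η s ≠ 0 := by
    intro σ₁ hσ₁
    refine differentiableOn_partialAsaiL_of_norm_sub_one_le
      (u := fun v => (2 : ℝ) ^ K * (v.1.residueCard : ℝ) ^ (-σ₁))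
      (((summable_residueCard_rpow_neg hσ₁).subtype _).mul_left ((2 : ℝ) ^ K))
      (fun v s hs => ?_) (fun v s hs => ?_)
    · -- `‖P_v(s) - 1‖ ≤ (2^K' - 1) ‖x‖ ≤ 2^K q_v^{-σ₁}`
      have hs' : σ₁ < s.re := hs
      have hq1 : (1 : ℝ) < v.1.residueCard := by exact_mod_cast v.1.one_lt_residueCard
      have hq0 : (0 : ℝ) < v.1.residueCard := zero_lt_one.trans hq1
      have hxle : ‖(v.1.residueCard : ℂ) ^ (-s)‖ ≤ (v.1.residueCard : ℝ) ^ (-σ₁) := by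
        rw [hx]
        exact Real.rpow_le_rpow_of_exponent_le hq1.le (by linarith)
      have hx1 : (v.1.residueCard : ℝ) ^ (-σ₁) ≤ 1 :=
        Real.rpow_le_one_of_one_le_of_nonpos hq1.le (by linarith)
      obtain ⟨hcard, hnorm⟩ := hA _ (hw v)
      obtain ⟨hcard', hnorm'⟩ := hA _ (hcw v)
      refine (norm_eval_asaiLocalPolynomial_sub_one_le c A η (placeAbove E v.1) (hxle.trans hx1)
        hnorm hnorm').trans ?_
      have hKle : Multiset.card (A (placeAbove E v.1)) +
            (Multiset.card (A (placeAbove E v.1))).choose 2 +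
          Multiset.card (A (placeAbove E v.1)) * Multiset.card (A (c • placeAbove E v.1)) ≤ K :=
        Nat.add_le_add (Nat.add_le_add hcard (Nat.choose_le_choose 2 hcard))
          (Nat.mul_le_mul hcard hcard')
      have h2 : (2 : ℝ) ^ (Multiset.card (A (placeAbove E v.1)) +
            (Multiset.card (A (placeAbove E v.1))).choose 2 +
          Multiset.card (A (placeAbove E v.1)) * Multiset.card (A (c • placeAbove E v.1))) ≤
          (2 : ℝ) ^ K := pow_le_pow_right₀ (by norm_num) hKle
      calc _ ≤ (2 : ℝ) ^ K * ‖(v.1.residueCard : ℂ) ^ (-s)‖ :=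
            mul_le_mul_of_nonneg_right (by linarith) (norm_nonneg _)
        _ ≤ (2 : ℝ) ^ K * (v.1.residueCard : ℝ) ^ (-σ₁) :=
            mul_le_mul_of_nonneg_left hxle (by positivity)
    · -- no factor vanishes: `‖x‖ ≤ q_v^{-σ₁} < 1`
      have hs' : σ₁ < s.re := hs
      have hq1 : (1 : ℝ) < v.1.residueCard := by exact_mod_cast v.1.one_lt_residueCard
      have hxlt : ‖(v.1.residueCard : ℂ) ^ (-s)‖ < 1 := by
        rw [hx]
        exact Real.rpow_lt_one_of_one_lt_of_neg hq1 (by linarith)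
      exact eval_asaiLocalPolynomial_ne_zero c A η (placeAbove E v.1) hxlt (hA _ (hw v)).2
        (hA _ (hcw v)).2
  refine ⟨differentiableOn_halfPlane_of_forall_lt_aux fun σ₁ hσ₁ => (key σ₁ hσ₁).1,
    fun s hs => ?_⟩
  have hs' : 1 < s.re := hs
  have h₁ : (1 : ℝ) < (1 + s.re) / 2 := by linarith
  have h₂ : (1 + s.re) / 2 < s.re := by linarith
  exact (key _ h₁).2 s h₂

end TemperedGlobal

/-! ### Tempered representations: the two currencies of an Asai pole agree -/

section TemperedBridges

variable {F E : Type} [Field F] [NumberField F] [Field E] [NumberField E] [Algebra F E]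
  {N : ℕ} {hcpt : isCompact_glFiniteIntegralLevel N E}
  {π : AutomorphicRepData (AutomorphyDatum.gl N E hcpt)} {c : E ≃ₐ[F] E} {η : ℤˣ}

/-- **For a `Π` satisfying the Ramanujan bound at its unramified places, the raw partial Asai
products of all its Asai data are holomorphic and non-zero on `{1 < Re s}`** (the hypothesis `hhol`
of the bridges above and of `Mok2014_standardBaseChange_descent_iff_continuation`, for this `Π`):
an Asai datum records Satake parameters of `Π` (`IsAsaiDatum.hasSatakeParamAt`), which have `N`
entries (`HasSatakeParamAt.card_eq`) of norm `≤ 1` by hypothesis; apply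
`differentiableOn_partialAsaiL_of_norm_le_one`. [folklore] -/
theorem AutomorphicRepData.IsAsaiDatum.differentiableOn_partialAsaiL_of_norm_le_one
    (htemp : ∀ (w : HeightOneSpectrum (𝓞 E)) (α : Multiset ℂ), π.HasSatakeParamAt w α →
      ∀ a ∈ α, ‖a‖ ≤ 1)
    {S : Set (HeightOneSpectrum (𝓞 F))} {A : SatakeFamily E} (hSA : π.IsAsaiDatum c S A) (θ : ℤˣ) :
    DifferentiableOn ℂ (partialAsaiL S c A θ) {s : ℂ | 1 < s.re} ∧
      ∀ s : ℂ, 1 < s.re → partialAsaiL S c A θ s ≠ 0 :=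
  _root_.Literature.NumberTheory.Automorphic.differentiableOn_partialAsaiL_of_norm_le_one c θ N
    fun w hw => ⟨(hSA.hasSatakeParamAt hw).card_eq.le, htemp w (A w) (hSA.hasSatakeParamAt hw)⟩

/-- **Tempered case of `hasAsaiPole_of_continuation`: a continued simple pole is a raw pole.** If
`Π` satisfies the Ramanujan bound `‖a‖ ≤ 1` on its Satake parameters at the unramified places
(e.g. `Π` regular algebraic conjugate self-dual cuspidal) and, for every Asai datum `(S, A)`,
`(s - 1) L^S(s, Π, As^η)` agrees on a right half-plane with a function `G` holomorphic on
`{1/2 < Re s}`, `G(1) ≠ 0` (a simple pole of the CONTINUED partial Asai `L`-function — the printed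
currency of Mok, Thm. 2.5.4 (a)), then `Π.HasAsaiPole c η` (the raw-limit currency of `AsaiSign`),
unconditionally: the holomorphy of the raw products needed by the bridge is
`IsAsaiDatum.differentiableOn_partialAsaiL_of_norm_le_one`. [folklore] -/
theorem AutomorphicRepData.hasAsaiPole_of_continuation_of_norm_le_one
    (htemp : ∀ (w : HeightOneSpectrum (𝓞 E)) (α : Multiset ℂ), π.HasSatakeParamAt w α →
      ∀ a ∈ α, ‖a‖ ≤ 1)
    (hcont : ∀ ⦃S : Set (HeightOneSpectrum (𝓞 F))⦄ ⦃A : SatakeFamily E⦄, π.IsAsaiDatum c S A →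
      ∃ σ₀ : ℝ, 1 ≤ σ₀ ∧ ∃ G : ℂ → ℂ, DifferentiableOn ℂ G {s : ℂ | 1 / 2 < s.re} ∧
        (∀ s : ℂ, σ₀ < s.re → G s = (s - 1) * partialAsaiL S c A η s) ∧ G 1 ≠ 0) :
    π.HasAsaiPole c η :=
  hasAsaiPole_of_continuation
    (fun _ _ hSA => (hSA.differentiableOn_partialAsaiL_of_norm_le_one htemp η).1) hcont

/-- **Tempered case of `HasAsaiPole.false_of_holomorphic_continuation`: a raw pole excludes a
holomorphic continuation.** For `Π` satisfying the Ramanujan bound at its unramified places, a raw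
pole `Π.HasAsaiPole c η` is incompatible with a continuation of `L^S(s, Π, As^η)` (some Asai datum)
holomorphic on `{1/2 < Re s}` — so, granted the corrected dichotomy for `Π`
(`Mok2014_partialAsaiL_pole_dichotomy_of_continuation`, hypothesis `h`), a raw pole at `η` IS the
continued pole at `η`. [folklore] -/
theorem AutomorphicRepData.HasAsaiPole.false_of_holomorphic_continuation_of_norm_le_one
    (hpole : π.HasAsaiPole c η)
    (htemp : ∀ (w : HeightOneSpectrum (𝓞 E)) (α : Multiset ℂ), π.HasSatakeParamAt w α →
      ∀ a ∈ α, ‖a‖ ≤ 1)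
    {S : Set (HeightOneSpectrum (𝓞 F))} {A : SatakeFamily E} (hSA : π.IsAsaiDatum c S A)
    {σ₀ : ℝ} (hσ₀ : 1 ≤ σ₀) {H : ℂ → ℂ} (hH : DifferentiableOn ℂ H {s : ℂ | 1 / 2 < s.re})
    (hHL : ∀ s : ℂ, σ₀ < s.re → H s = partialAsaiL S c A η s) : False :=
  hpole.false_of_holomorphic_continuation hSA
    (hSA.differentiableOn_partialAsaiL_of_norm_le_one htemp η).1 hσ₀ hH hHL

/-- **Using the vendored (raw-currency) descent with the printed hypothesis, for tempered `Π`.**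
Assume `Mok2014_standardBaseChange_descent` (as vendored). Let `Π` be a cuspidal automorphic
representation datum of `GL_N(𝔸_E)`, `N ≥ 1`, conjugate self-dual a.e., satisfying the Ramanujan
bound at its unramified places, whose CONTINUED partial Asai `L`-functions of sign `(-1)^{N-1}` have a
simple pole at `s = 1` (for every Asai datum: `(s - 1) L^S(s, Π, As^{(-1)^{N-1}})` extends from a
right half-plane to a function holomorphic on `{1/2 < Re s}`, non-zero at `1` — Mok, Thm. 2.5.4 (a)
/ Remark 2.5.5, the printed criterion). Then `Π` is a weak base change of some automorphic
representation datum of `U_{E/F}(N)(𝔸_F)`: the raw hypothesis `HasAsaiSign Π c 1` of the vendored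
fact follows from the printed one by `hasAsaiPole_of_continuation_of_norm_le_one`. This is the form
in which the fact is usable for regular algebraic conjugate self-dual cuspidal `Π` (tempered at all
finite places). [cite: Mok2014, Thm. 2.4.2 (arXiv p. 13), Thm. 2.5.4 (a) and Remark 2.5.5 (arXiv pp. 20–21)] -/
theorem Mok2014_standardBaseChange_descent.exists_isWeakBaseChange_of_continuation
    (hD : Mok2014_standardBaseChange_descent) (c : E ≃ₐ[F] E) (h2 : Module.finrank F E = 2)
    (hc : c ≠ 1) (P : CuspidalAutomorphicRepData N E hcpt) (hN : 0 < N)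
    (hcsd : P.1.IsConjSelfDualAE c)
    (htemp : ∀ (w : HeightOneSpectrum (𝓞 E)) (α : Multiset ℂ), P.1.HasSatakeParamAt w α →
      ∀ a ∈ α, ‖a‖ ≤ 1)
    (hcont : ∀ ⦃S : Set (HeightOneSpectrum (𝓞 F))⦄ ⦃A : SatakeFamily E⦄, P.1.IsAsaiDatum c S A →
      ∃ σ₀ : ℝ, 1 ≤ σ₀ ∧ ∃ G : ℂ → ℂ, DifferentiableOn ℂ G {s : ℂ | 1 / 2 < s.re} ∧
        (∀ s : ℂ, σ₀ < s.re → G s = (s - 1) * partialAsaiL S c A ((-1) ^ (N + 1)) s) ∧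
          G 1 ≠ 0) :
    ∃ π : UnitaryGroupAutomorphicRep F E c N hcpt,
      UnitaryGroup.IsWeakBaseChange F E c N hcpt P.1 π := by
  refine hD F E c h2 hc N hcpt P hN hcsd ?_
  rw [AutomorphicRepData.hasAsaiSign_iff, mul_one]
  exact AutomorphicRepData.hasAsaiPole_of_continuation_of_norm_le_one htemp hcont

end TemperedBridges

end Literature.NumberTheory.Automorphic
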